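import Mathlib.LinearAlgebra.Alternating.Curry
import Mathlib.LinearAlgebra.Matrix.Determinant.Basic
import Mathlib.LinearAlgebra.Matrix.NonsingularInverse
import Mathlib.Topology.Algebra.Module.FiniteDimension
import Mathlib.Topology.Instances.Matrix
import Mathlib.Analysis.Normed.Module.Alternating.Basic
import Mathlib.Analysis.Complex.Basic
import HarnessLib

/-!
# The cone residue form of a projective hypersurface: pointwise linear algebra

Family `hodge`, layer `Literature/AlgebraicGeometry/HodgeTheory`. Support for the (future) proof of
the named fact `Voisin2003_hypersurface_residueForm` (file `HypersurfaceResidueForms`): the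
non-zero holomorphic `m`-form on a smooth hypersurface `Y = {F = 0} ⊂ ℙ^{m+1}(ℂ)` of degree
`d ≥ m + 2` is Griffiths' residue `Res_Y(PΩ/F)` (Voisin II, §6.1.1: `Res(α ∧ dF/F) = α|_Y`;
§6.1.3: `Ω = Σ (-1)ⁱ Xᵢ dX₀ ∧ ⋯ ∧ d̂Xᵢ ∧ ⋯ ∧ dX_{m+1} = ι_E(dX₀ ∧ ⋯ ∧ dX_{m+1})`, `E` the Euler
field). Pointwise, on the cone `C = {F = 0} ⊂ V = ℂ^{m+2}` at `z`, with `N` any vector such that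
`dF(z)N = 1`, this residue is the `m`-form `(w₁, …, w_m) ↦ det(N, z, w₁, …, w_m)` on
`T_z C = ker dF(z)` (`dX₀ ∧ ⋯ ∧ dX_{m+1} = det`), to be pulled back along the differential
`L : E → V` of a local holomorphic lift of the embedding of the abstract model. This file is the
**choice-free linear algebra** of that recipe (no analysis, no geometry):

* `coneResidue N z L : E [⋀^Fin m]→L[ℂ] ℂ`, `v ↦ det(N, z, L v₁, …, L v_m)` (a continuous
  `ℂ`-alternating form; `coneResidue_apply`);
* independence of the normal vector: adding to `N` a vector of a subspace `K ⊇ {z} ∪ range L` of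
  dimension `≤ m + 1` changes nothing (`coneResidue_eq_zero_of_mem`, `coneResidue_add_left_eq`
  for `K = ker ℓ`, `ℓ = dF(z) ≠ 0`, `finrank_ker_of_linearForm_ne_zero`);
* change of lift: `L' = g • L + φ ⊗ z` (the differential of `g • Z̃` for a scalar function `g`
  with `dg = φ`, up to the `z`-direction) multiplies the form by `g ^ m`
  (`coneResidue_lift_change`; row operations `coneA_add_smul`), and the scalings
  `coneResidue_smul_left/mid/right`, `coneResidue_add_left` — together the degree-`0`
  homogeneity making `P · det(N, z, L ·)` descend from the cone when `deg P = d - m - 2`;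
* non-vanishing: the form is non-zero as soon as the rows `N, z, L v₁, …, L v_m` are linearly
  independent (`coneResidue_apply_ne_zero_of_linearIndependent`), which holds when a functional
  `ℓ` separates `N` from `z` and `range L`, the `vᵢ` are independent and `(x, c) ↦ L x + c z`
  is injective on their span (`linearIndependent_coneRows`).

## References

* C. Voisin, *Hodge Theory and Complex Algebraic Geometry II* (2003), §6.1.1, §6.1.3.
* P. Griffiths, On the periods of certain rational integrals I, Ann. of Math. 90 (1969), §2, §8.
-/

noncomputable section

open Matrix

namespace Literature.AlgebraicGeometry.HodgeTheory

variable {m : ℕ} {E : Type*} [NormedAddCommGroup E] [NormedSpace ℂ E]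

/-! ### Definition -/

/-- The cone residue form as an algebraic alternating map: `v ↦ det(N, z, L v₁, …, L v_m)`,
built from `Matrix.detRowAlternating` by currying the first two rows and composing with `L`.
Pointwise value of Griffiths' residue `Res(Ω/F)` (Voisin II, §6.1.1, §6.1.3). [folklore] -/
def coneResidueAlg (N z : Fin (m + 2) → ℂ) (L : E →ₗ[ℂ] (Fin (m + 2) → ℂ)) :
    E [⋀^Fin m]→ₗ[ℂ] ℂ :=
  (((Matrix.detRowAlternating : (Fin (m + 2) → ℂ) [⋀^Fin (m + 2)]→ₗ[ℂ] ℂ).curryLeft N).curryLeft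
    z).compLinearMap L

/-- `coneResidueAlg N z L v = det(N, z, L v₁, …, L v_m)` (rows of the matrix). [folklore] -/
theorem coneResidueAlg_apply (N z : Fin (m + 2) → ℂ) (L : E →ₗ[ℂ] (Fin (m + 2) → ℂ))
    (v : Fin m → E) :
    coneResidueAlg N z L v = Matrix.det (Matrix.of (vecCons N (vecCons z fun i ↦ L (v i)))) := by
  simp [coneResidueAlg, AlternatingMap.curryLeft_apply_apply, Matrix.detRowAlternating]
  rfl

/-- The cone residue form is continuous (a determinant of continuous entries). [folklore] -/
theorem continuous_coneResidueAlg (N z : Fin (m + 2) → ℂ) (L : E →L[ℂ] (Fin (m + 2) → ℂ)) :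
    Continuous (coneResidueAlg N z (L : E →ₗ[ℂ] (Fin (m + 2) → ℂ))) := by
  have : ⇑(coneResidueAlg N z (L : E →ₗ[ℂ] (Fin (m + 2) → ℂ))) =
      fun v ↦ Matrix.det (Matrix.of (vecCons N (vecCons z fun i ↦ L (v i)))) := by
    funext v; exact coneResidueAlg_apply N z L v
  rw [this]
  refine Continuous.matrix_det ?_
  refine continuous_pi fun r ↦ continuous_pi fun c ↦ ?_
  simp only [of_apply]
  refine Fin.cases ?_ (fun r' ↦ ?_) r
  · simp only [cons_val_zero]; exact continuous_const
  · refine Fin.cases ?_ (fun i ↦ ?_) r'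
    · simp only [cons_val_succ, cons_val_zero]; exact continuous_const
    · simp only [cons_val_succ]
      exact (continuous_apply c).comp (L.continuous.comp (continuous_apply i))

/-- **The cone residue form** `v ↦ det(N, z, L v₁, …, L v_m)` as a continuous `ℂ`-alternating
`m`-form on `E`: the pointwise value of `Res(Ω/F)` on the hypersurface cone at `z` (normal vector
`N`, `dF(z)N = 1`), pulled back along `L` (Voisin II, §6.1.1, §6.1.3).
[cite: VoisinHodgeII2003, §6.1.1 and §6.1.3] -/
def coneResidue (N z : Fin (m + 2) → ℂ) (L : E →L[ℂ] (Fin (m + 2) → ℂ)) : E [⋀^Fin m]→L[ℂ] ℂ :=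
  { coneResidueAlg N z (L : E →ₗ[ℂ] (Fin (m + 2) → ℂ)) with
    cont := continuous_coneResidueAlg N z L }

/-- `coneResidue N z L v = det(N, z, L v₁, …, L v_m)`. [folklore] -/
@[simp]
theorem coneResidue_apply (N z : Fin (m + 2) → ℂ) (L : E →L[ℂ] (Fin (m + 2) → ℂ)) (v : Fin m → E) :
    coneResidue N z L v = Matrix.det (Matrix.of (vecCons N (vecCons z fun i ↦ L (v i)))) :=
  coneResidueAlg_apply N z (L : E →ₗ[ℂ] (Fin (m + 2) → ℂ)) v

/-- The rows `(N, z, L v₁, …, L v_m)` of the cone residue determinant. [folklore] -/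
def coneRows (N z : Fin (m + 2) → ℂ) (L : E →L[ℂ] (Fin (m + 2) → ℂ)) (v : Fin m → E) :
    Fin (m + 2) → Fin (m + 2) → ℂ :=
  vecCons N (vecCons z fun i ↦ L (v i))

/-- `coneResidue` as `Matrix.detRowAlternating` of `coneRows`. [folklore] -/
theorem coneResidue_apply_eq_detRowAlternating (N z : Fin (m + 2) → ℂ)
    (L : E →L[ℂ] (Fin (m + 2) → ℂ)) (v : Fin m → E) :
    coneResidue N z L v = Matrix.detRowAlternating (coneRows N z L v) := by
  rw [coneResidue_apply]; rfl

/-! ### Independence of the normal vector -/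

/-- **Vanishing on small subspaces**: if `N`, `z` and all `L x` lie in a subspace `K` of dimension
`≤ m + 1`, the cone residue form vanishes (its `m + 2` rows are linearly dependent,
`AlternatingMap.map_linearDependent`). [folklore] -/
theorem coneResidue_eq_zero_of_mem (K : Submodule ℂ (Fin (m + 2) → ℂ))
    (hK : Module.finrank ℂ K ≤ m + 1) {N z : Fin (m + 2) → ℂ} {L : E →L[ℂ] (Fin (m + 2) → ℂ)}
    (hN : N ∈ K) (hz : z ∈ K) (hL : ∀ x, L x ∈ K) : coneResidue N z L = 0 := by
  ext v
  rw [coneResidue_apply_eq_detRowAlternating, ContinuousAlternatingMap.coe_zero, Pi.zero_apply]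
  apply AlternatingMap.map_linearDependent
  intro hli
  have hmem : ∀ i, coneRows N z L v i ∈ K := by
    intro i
    refine Fin.cases ?_ (fun i' ↦ Fin.cases ?_ (fun j ↦ ?_) i') i
    · simpa [coneRows] using hN
    · simpa [coneRows] using hz
    · simpa [coneRows] using hL (v j)
  have hli' : LinearIndependent ℂ (fun i ↦ (⟨coneRows N z L v i, hmem i⟩ : K)) :=
    LinearIndependent.of_comp K.subtype (by simpa [Function.comp_def] using hli)
  have := hli'.fintype_card_le_finrank
  simp only [Fintype.card_fin] at this
  omega

/-- The cone residue form is additive in the normal vector. [folklore] -/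
theorem coneResidue_add_left (N t z : Fin (m + 2) → ℂ) (L : E →L[ℂ] (Fin (m + 2) → ℂ)) :
    coneResidue (N + t) z L = coneResidue N z L + coneResidue t z L := by
  ext v
  simp only [coneResidue_apply_eq_detRowAlternating, ContinuousAlternatingMap.add_apply]
  exact (Matrix.detRowAlternating (n := Fin (m + 2)) (R := ℂ)).toMultilinearMap.cons_add _ N t

/-- The kernel of a non-zero linear functional on `ℂ^{m+2}` has dimension `m + 1`
(rank–nullity). [folklore] -/
theorem finrank_ker_of_linearForm_ne_zero (ℓ : (Fin (m + 2) → ℂ) →ₗ[ℂ] ℂ) (hℓ : ℓ ≠ 0) :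
    Module.finrank ℂ (LinearMap.ker ℓ) = m + 1 := by
  have hr : LinearMap.range ℓ = ⊤ := by
    refine (Ideal.eq_bot_or_top (LinearMap.range ℓ)).resolve_left ?_
    intro h
    exact hℓ (LinearMap.range_eq_bot.mp h)
  have h := LinearMap.finrank_range_add_finrank_ker ℓ
  rw [hr, finrank_top, Module.finrank_self, Module.finrank_fin_fun] at h
  omega

/-- **Independence of the normal vector.** If `ℓ ≠ 0` (`ℓ = dF(z)`) kills `t`, `z` and
`range L` (tangent data), then replacing `N` by `N + t` does not change the cone residue form:
the residue `det(N, z, ·)|_{ker dF}` depends on `N` only through `dF(z)N`. [folklore] -/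
theorem coneResidue_add_left_eq (ℓ : (Fin (m + 2) → ℂ) →ₗ[ℂ] ℂ) (hℓ : ℓ ≠ 0)
    {N t z : Fin (m + 2) → ℂ} {L : E →L[ℂ] (Fin (m + 2) → ℂ)}
    (ht : ℓ t = 0) (hz : ℓ z = 0) (hL : ∀ x, ℓ (L x) = 0) :
    coneResidue (N + t) z L = coneResidue N z L := by
  have h0 : coneResidue t z L = 0 :=
    coneResidue_eq_zero_of_mem (LinearMap.ker ℓ) (finrank_ker_of_linearForm_ne_zero ℓ hℓ).le
      (by simpa using ht) (by simpa using hz) (by simpa using hL)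
  rw [coneResidue_add_left, h0, add_zero]

/-! ### Row operations and change of lift -/

/-- The `(m+1)`-form `det(N, ·)` on `ℂ^{m+2}`. [folklore] -/
def coneB (N : Fin (m + 2) → ℂ) : (Fin (m + 2) → ℂ) [⋀^Fin (m + 1)]→ₗ[ℂ] ℂ :=
  (Matrix.detRowAlternating : (Fin (m + 2) → ℂ) [⋀^Fin (m + 2)]→ₗ[ℂ] ℂ).curryLeft N

/-- The `m`-form `det(N, z, ·)` on `ℂ^{m+2}`. [folklore] -/
def coneA (N z : Fin (m + 2) → ℂ) : (Fin (m + 2) → ℂ) [⋀^Fin m]→ₗ[ℂ] ℂ := (coneB N).curryLeft z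

/-- `coneA N z w = coneB N (z, w)`. [folklore] -/
theorem coneA_apply (N z : Fin (m + 2) → ℂ) (w : Fin m → Fin (m + 2) → ℂ) :
    coneA N z w = coneB N (vecCons z w) :=
  AlternatingMap.curryLeft_apply_apply _ _ _

/-- `coneResidue N z L` is `coneA N z` pulled back along `L`. [folklore] -/
theorem coneResidue_eq_coneA (N z : Fin (m + 2) → ℂ) (L : E →L[ℂ] (Fin (m + 2) → ℂ))
    (v : Fin m → E) : coneResidue N z L v = coneA N z (fun i ↦ L (v i)) := rfl

/-- `det(N, z, w)` vanishes as soon as some `wᵢ` is a multiple of `z` (repeated row).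
[folklore] -/
theorem coneA_eq_zero_of_apply_eq_smul (N z : Fin (m + 2) → ℂ) (w : Fin m → Fin (m + 2) → ℂ)
    (i : Fin m) (c : ℂ) (hw : w i = c • z) : coneA N z w = 0 := by
  rw [coneA_apply]
  have h1 : (vecCons z w : Fin (m + 1) → Fin (m + 2) → ℂ) =
      Function.update (vecCons z w) i.succ (c • (vecCons z w : Fin (m + 1) → Fin (m + 2) → ℂ) 0) := by
    rw [cons_val_zero, ← hw]
    conv_lhs => rw [← Function.update_eq_self i.succ (vecCons z w : Fin (m + 1) → Fin (m + 2) → ℂ)]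
    rw [cons_val_succ]
  rw [h1, AlternatingMap.map_update_smul, AlternatingMap.map_update_self _ _ (Fin.succ_ne_zero i),
    smul_zero]

/-- **Row operations**: adding multiples of `z` to the arguments does not change `det(N, z, ·)`
(expand multilinearly, `MultilinearMap.map_add_univ`; every term but the main one has a row
proportional to `z`). [folklore] -/
theorem coneA_add_smul (N z : Fin (m + 2) → ℂ) (w : Fin m → Fin (m + 2) → ℂ) (a : Fin m → ℂ) :
    coneA N z (fun i ↦ w i + a i • z) = coneA N z w := by
  classical
  have := MultilinearMap.map_add_univ (coneA N z).toMultilinearMap w (fun i ↦ a i • z)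
  simp only [AlternatingMap.coe_multilinearMap] at this
  rw [show (fun i ↦ w i + a i • z) = w + fun i ↦ a i • z from rfl, this,
    ← Finset.sum_erase_add _ _ (Finset.mem_univ (Finset.univ : Finset (Fin m))),
    Finset.piecewise_univ, Finset.sum_eq_zero, zero_add]
  intro s hs
  obtain ⟨hs, -⟩ := Finset.mem_erase.mp hs
  obtain ⟨i, hi⟩ : ∃ i, i ∉ s := by
    by_contra h
    exact hs (Finset.eq_univ_iff_forall.mpr (by simpa using h))
  exact coneA_eq_zero_of_apply_eq_smul N z _ i (a i) (by simp [Finset.piecewise, hi])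

/-- **Change of lift.** If the lift `Z̃` of the embedding is replaced by `g • Z̃`, its differential
`L` becomes `g • L + φ ⊗ z` (`φ = dg`, `z = Z̃(x)`); the cone residue form is then multiplied by
`g ^ m` (the `φ ⊗ z` part dies by `coneA_add_smul`). With the factors `g` from the row `z` and
`g^{1-d}` from the normal vector (`dF(gz) = g^{d-1} dF(z)`) and `g^{d-m-2}` from `P`, this is the
degree-`0` homogeneity of `P · Res(Ω/F)` (Voisin II, §6.1.3). [folklore] -/
theorem coneResidue_lift_change (N z : Fin (m + 2) → ℂ) (L : E →L[ℂ] (Fin (m + 2) → ℂ)) (g : ℂ)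
    (φ : E →L[ℂ] ℂ) : coneResidue N z (g • L + φ.smulRight z) = g ^ m • coneResidue N z L := by
  ext v
  rw [coneResidue_eq_coneA, ContinuousAlternatingMap.smul_apply, coneResidue_eq_coneA]
  have h1 : (fun i ↦ (g • L + φ.smulRight z) (v i)) = fun i ↦ g • L (v i) + φ (v i) • z := by
    funext i; simp
  have h2 : coneA N z (fun i ↦ g • L (v i)) = (∏ _i : Fin m, g) • coneA N z (fun i ↦ L (v i)) :=
    (coneA N z).toMultilinearMap.map_smul_univ (fun _ ↦ g) (fun j ↦ L (v j))
  rw [h1, coneA_add_smul, h2]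
  simp

/-- Scaling the lift differential scales the form by `c ^ m`. [folklore] -/
theorem coneResidue_smul_right (c : ℂ) (N z : Fin (m + 2) → ℂ) (L : E →L[ℂ] (Fin (m + 2) → ℂ)) :
    coneResidue N z (c • L) = c ^ m • coneResidue N z L := by
  simpa using coneResidue_lift_change N z L c 0

/-- The cone residue form is linear in the normal vector `N`. [folklore] -/
theorem coneResidue_smul_left (c : ℂ) (N z : Fin (m + 2) → ℂ) (L : E →L[ℂ] (Fin (m + 2) → ℂ)) :
    coneResidue (c • N) z L = c • coneResidue N z L := by
  ext v
  simp only [coneResidue_apply_eq_detRowAlternating, ContinuousAlternatingMap.smul_apply]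
  change Matrix.detRowAlternating (Fin.cons (c • N) (Fin.cons z fun i ↦ L (v i))) =
    c • Matrix.detRowAlternating (Fin.cons N (Fin.cons z fun i ↦ L (v i)))
  exact (Matrix.detRowAlternating (n := Fin (m + 2)) (R := ℂ)).toMultilinearMap.cons_smul _ c N

/-- The cone residue form is linear in the cone point `z`. [folklore] -/
theorem coneResidue_smul_mid (c : ℂ) (N z : Fin (m + 2) → ℂ) (L : E →L[ℂ] (Fin (m + 2) → ℂ)) :
    coneResidue N (c • z) L = c • coneResidue N z L := by
  ext v
  rw [coneResidue_eq_coneA, ContinuousAlternatingMap.smul_apply, coneResidue_eq_coneA,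
    coneA_apply, coneA_apply]
  exact (coneB N).toMultilinearMap.cons_smul _ c z

/-! ### Non-vanishing -/

/-- **Non-vanishing**: the cone residue form is non-zero on `v` as soon as the rows
`N, z, L v₁, …, L v_m` are linearly independent (an invertible matrix has non-zero determinant).
[folklore] -/
theorem coneResidue_apply_ne_zero_of_linearIndependent (N z : Fin (m + 2) → ℂ)
    (L : E →L[ℂ] (Fin (m + 2) → ℂ)) (v : Fin m → E) (h : LinearIndependent ℂ (coneRows N z L v)) :
    coneResidue N z L v ≠ 0 := by
  classical
  rw [coneResidue_apply]
  have hU : IsUnit (Matrix.of (coneRows N z L v)) :=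
    (Matrix.linearIndependent_rows_iff_isUnit).mp (by simpa using h)
  exact ((Matrix.isUnit_iff_isUnit_det _).mp hU).ne_zero

/-- **Linear independence of the rows from tangency data.** If a functional `ℓ` (`= dF(z)`) has
`ℓ N ≠ 0`, `ℓ z = 0`, `ℓ ∘ L = 0`, the vectors `vᵢ` are linearly independent, and
`(x, c) ↦ L x + c z` is injective on `span(vᵢ) × ℂ` (the lift differential is injective and
transverse to the Euler direction), then the rows `N, z, L v₁, …, L v_m` are linearly
independent (`linearIndependent_finCons` twice). [folklore] -/
theorem linearIndependent_coneRows (N z : Fin (m + 2) → ℂ) (L : E →L[ℂ] (Fin (m + 2) → ℂ))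
    (v : Fin m → E) (ℓ : (Fin (m + 2) → ℂ) →ₗ[ℂ] ℂ) (hN : ℓ N ≠ 0) (hz : ℓ z = 0)
    (hL : ∀ x, ℓ (L x) = 0) (hv : LinearIndependent ℂ v)
    (hinj : ∀ (x : E) (c : ℂ), x ∈ Submodule.span ℂ (Set.range v) → L x + c • z = 0 →
      x = 0 ∧ c = 0) :
    LinearIndependent ℂ (coneRows N z L v) := by
  -- the `L vᵢ` are independent and `z` is not in their span
  have h1 : LinearIndependent ℂ (fun i ↦ L (v i)) := by
    rw [Fintype.linearIndependent_iff]
    intro g hg i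
    have hx : (∑ i, g i • v i) ∈ Submodule.span ℂ (Set.range v) :=
      Submodule.sum_mem _ fun i _ ↦ Submodule.smul_mem _ _ (Submodule.subset_span ⟨i, rfl⟩)
    have hsum : L (∑ i, g i • v i) + (0 : ℂ) • z = 0 := by simpa [map_sum, map_smul] using hg
    have := (hinj _ 0 hx hsum).1
    exact (Fintype.linearIndependent_iff.mp hv g this) i
  have h2 : z ∉ Submodule.span ℂ (Set.range fun i ↦ L (v i)) := by
    intro hzmem
    have : Submodule.span ℂ (Set.range fun i ↦ L (v i)) =
        (Submodule.span ℂ (Set.range v)).map (L : E →ₗ[ℂ] (Fin (m + 2) → ℂ)) := by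
      rw [Submodule.map_span, ← Set.range_comp]; rfl
    rw [this] at hzmem
    obtain ⟨x, hx, hxz⟩ := hzmem
    have hxz' : L x = z := hxz
    have := hinj x (-1) hx (by rw [hxz']; simp)
    norm_num at this
  have h3 : N ∉ Submodule.span ℂ
      (Set.range (vecCons z fun i ↦ L (v i) : Fin (m + 1) → Fin (m + 2) → ℂ)) := by
    intro hNmem
    have hle : Submodule.span ℂ
        (Set.range (vecCons z fun i ↦ L (v i) : Fin (m + 1) → Fin (m + 2) → ℂ)) ≤
        LinearMap.ker ℓ := by
      refine Submodule.span_le.mpr ?_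
      rintro _ ⟨i, rfl⟩
      refine Fin.cases ?_ (fun j ↦ ?_) i
      · simpa using hz
      · simpa using hL (v j)
    exact hN (hle hNmem)
  unfold coneRows
  refine (linearIndependent_finCons (x := N)).mpr ⟨?_, h3⟩
  exact (linearIndependent_finCons (x := z)).mpr ⟨h1, h2⟩

end Literature.AlgebraicGeometry.HodgeTheory

end
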